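import Summits.NavierStokesRegularity.NavierStokesRegularity.Theorems.SelfMixingDichotomyCoherentScaleExclusionKinWitnessLoadLowerBound
import Summits.NavierStokesRegularity.NavierStokesRegularity.Theorems.SelfMixingDichotomyCoherentScaleExclusionKinWitnessLoadPiece
import HarnessLib

-- single-conjunct summit (`<Problem> = <Summit>`): the duplicated namespace component is by design
set_option linter.dupNamespace false

/-!
# Route SelfMixingDichotomy — crux `CoherentScaleExclusion` (S2, item stmt-NavierStokesRegularity-1423),
# line `registered`, stub SSW2 `stub_selfSimilarSwirl_loadFloor`

Support file (`--supports stmt-NavierStokesRegularity-1423`) of the line lead c3 for the registered stub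
`stub_selfSimilarSwirl_loadFloor`: the scaled cubic load of the exactly self-similar swirling eddy

  `uA t x = (A (1 − t)⁻¹ expNegInvGlue (4 − ‖x‖² / (1 − t))) • J x`  (`t < 1`, else `0`),
  `J x = (−x₁, x₀, 0)`,

at its tip `(T, x₀) = (1, 0)` is bounded BELOW by `κ A³` at EVERY scale `r > 0`, with a universal `κ > 0`
(`C(r) = cknC r (1, 0) uA = r⁻² ∫∫_{Q_r(1,0)} ‖uA‖³`; by exact self-similarity `C(r)` does not depend on `r`).

Proof. On the window `1 − t ∈ (r²/5, r²/4)` (i.e. `t ∈ (1 − r²/4, 1 − r²/5) ⊆ (1 − r², 1)`) and the ball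
`B((3r/5) e₀, r/20) ⊆ B(0, r)` one has `‖x‖ < 13r/20`, `|x₀| ≥ 11r/20`, hence `‖x‖² ≤ 3 (1 − t)`, the
profile is `≥ expNegInvGlue 1`, the amplitude is `(1 − t)⁻¹ ≥ 4/r²` and `‖J x‖ ≥ |x₀| ≥ 11r/20`, so
`‖uA t x‖ ≥ m := A · (4/r²) · expNegInvGlue 1 · (11r/20)`. The generic lower bound
`kinWitness_cknC_lowerBound_of_le_norm` (`…KinWitnessLoadLowerBound`) gives
`C(r) ≥ ofReal ((b − a) s³ m³ / r²) |B₁|`, and `(b − a) s³ m³ / r² = (1331/20000000) (expNegInvGlue 1)³ A³`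
is scale free; `κ := (1331/20000000) (expNegInvGlue 1)³ |B₁|`. Mathlib only (plus the two landed sibling
files); no definition, no named fact taken as a hypothesis.
-/

noncomputable section

open MeasureTheory Set Metric
open Literature.Analysis.FluidPDE

namespace Summit.NavierStokesRegularity.NavierStokesRegularity.Theorems

/-- Norm control on the ball `B((3r/5) e₀, r/20)` of `ℝ³` (`r > 0`): every point has `‖x‖ < 13r/20` and
first coordinate `|x₀| ≥ 11r/20`. -/
theorem selfSimilarSwirl_loadFloor_ball {r : ℝ} (hr : 0 < r) (x : EuclideanSpace ℝ (Fin 3))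
    (hx : x ∈ Metric.ball (EuclideanSpace.single 0 (3 * r / 5) : EuclideanSpace ℝ (Fin 3)) (r / 20)) :
    ‖x‖ < 13 * r / 20 ∧ 11 * r / 20 ≤ |x 0| := by
  have hcn : ‖(EuclideanSpace.single 0 (3 * r / 5) : EuclideanSpace ℝ (Fin 3))‖ = 3 * r / 5 := by
    rw [PiLp.norm_single, Real.norm_eq_abs, abs_of_pos (by positivity)]
  have hc0 : (EuclideanSpace.single 0 (3 * r / 5) : EuclideanSpace ℝ (Fin 3)) 0 = 3 * r / 5 := by
    simp
  rw [Metric.mem_ball, dist_eq_norm] at hx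
  refine ⟨?_, ?_⟩
  · have := norm_sub_norm_le x (EuclideanSpace.single 0 (3 * r / 5) : EuclideanSpace ℝ (Fin 3))
    linarith
  · have h1 := kinWitness_loadPiece_abs_sub_apply_le x
      (EuclideanSpace.single 0 (3 * r / 5) : EuclideanSpace ℝ (Fin 3))
    rw [hc0] at h1
    have h2 := abs_sub_abs_le_abs_sub (3 * r / 5) (x 0)
    rw [abs_sub_comm, abs_of_pos (show (0 : ℝ) < 3 * r / 5 by positivity)] at h2
    linarith

/-- Pointwise floor of the self-similar swirling eddy on the product sub-region: for `0 ≤ A`, `0 < r`,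
`t ∈ (1 − r²/4, 1 − r²/5)` and `x ∈ B((3r/5) e₀, r/20)`,
`A · (4/r²) · expNegInvGlue 1 · (11r/20) ≤ ‖uA t x‖`. -/
theorem selfSimilarSwirl_loadFloor_pointwise {A r : ℝ} (hA : 0 ≤ A) (hr : 0 < r) (t : ℝ)
    (ht : t ∈ Set.Ioo (1 - r ^ 2 / 4) (1 - r ^ 2 / 5)) (x : EuclideanSpace ℝ (Fin 3))
    (hx : x ∈ Metric.ball (EuclideanSpace.single 0 (3 * r / 5) : EuclideanSpace ℝ (Fin 3)) (r / 20)) :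
    A * (4 / r ^ 2) * expNegInvGlue 1 * (11 * r / 20) ≤
      ‖(fun (t : ℝ) (x : EuclideanSpace ℝ (Fin 3)) => if t < 1 then
          (A * (1 - t)⁻¹ * expNegInvGlue (4 - ‖x‖ ^ 2 / (1 - t))) •
            (WithLp.toLp 2 ![-(x 1), x 0, 0] : EuclideanSpace ℝ (Fin 3)) else 0) t x‖ := by
  obtain ⟨hta, htb⟩ := ht
  obtain ⟨hxn, hx0⟩ := selfSimilarSwirl_loadFloor_ball hr x hx
  have hr2 : 0 < r ^ 2 := pow_pos hr 2
  have ht1 : t < 1 := by linarith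
  have hτ : 0 < 1 - t := by linarith
  have hτu : 1 - t ≤ r ^ 2 / 4 := by linarith
  have hτl : r ^ 2 / 5 < 1 - t := by linarith
  dsimp only
  have hAG : 0 ≤ A * (1 - t)⁻¹ * expNegInvGlue (4 - ‖x‖ ^ 2 / (1 - t)) :=
    mul_nonneg (mul_nonneg hA (inv_nonneg.2 hτ.le)) (expNegInvGlue.nonneg _)
  rw [if_pos ht1, norm_smul, Real.norm_eq_abs, abs_of_nonneg hAG]
  -- amplitude floor `4/r² ≤ (1 - t)⁻¹`
  have hinv : 4 / r ^ 2 ≤ (1 - t)⁻¹ := by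
    have h := inv_anti₀ hτ hτu
    rwa [inv_div] at h
  -- profile floor `expNegInvGlue 1 ≤ expNegInvGlue (4 - ‖x‖²/(1 - t))`
  have hG : expNegInvGlue 1 ≤ expNegInvGlue (4 - ‖x‖ ^ 2 / (1 - t)) := by
    apply expNegInvGlue.monotone
    have hx2 : ‖x‖ ^ 2 < (13 * r / 20) ^ 2 := sq_lt_sq' (by linarith [norm_nonneg x]) hxn
    have hq : ‖x‖ ^ 2 / (1 - t) ≤ 3 := by
      rw [div_le_iff₀ hτ]
      nlinarith
    show (1 : ℝ) ≤ 4 - ‖x‖ ^ 2 / (1 - t)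
    linarith
  -- direction floor `11r/20 ≤ |x₀| ≤ ‖J x‖`
  have hJ : 11 * r / 20 ≤ ‖(WithLp.toLp 2 ![-(x 1), x 0, 0] : EuclideanSpace ℝ (Fin 3))‖ :=
    hx0.trans (kinWitness_loadPiece_abs_apply_le_norm_swirl x)
  have hA4 : A * (4 / r ^ 2) ≤ A * (1 - t)⁻¹ := mul_le_mul_of_nonneg_left hinv hA
  calc A * (4 / r ^ 2) * expNegInvGlue 1 * (11 * r / 20)
      ≤ A * (1 - t)⁻¹ * expNegInvGlue (4 - ‖x‖ ^ 2 / (1 - t)) * (11 * r / 20) :=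
        mul_le_mul_of_nonneg_right
          (mul_le_mul hA4 hG (expNegInvGlue.nonneg _) (mul_nonneg hA (inv_nonneg.2 hτ.le)))
          (by positivity)
    _ ≤ A * (1 - t)⁻¹ * expNegInvGlue (4 - ‖x‖ ^ 2 / (1 - t))
          * ‖(WithLp.toLp 2 ![-(x 1), x 0, 0] : EuclideanSpace ℝ (Fin 3))‖ :=
        mul_le_mul_of_nonneg_left hJ hAG

/-- **SSW2 — the load of the self-similar swirling eddy is bounded below by `κ A³` at every scale**
(registered sub-goal `stub_selfSimilarSwirl_loadFloor` of the crux `CoherentScaleExclusion`, line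
`registered`, lead c3; exact self-similarity: `C(r)` does not depend on `r`). On the window
`1 − t ∈ (r²/5, r²/4)` and the ball `B((3r/5) e₀, r/20)` the speed is
`≥ A · (4/r²) · expNegInvGlue 1 · (11r/20)` (`selfSimilarSwirl_loadFloor_pointwise`);
`kinWitness_cknC_lowerBound_of_le_norm` (`…KinWitnessLoadLowerBound`) turns the product sub-region into the
bound, with `κ = (1331/20000000) (expNegInvGlue 1)³ |B₁|`. -/
theorem stub_selfSimilarSwirl_loadFloor :
    ∃ κ : ℝ, 0 < κ ∧ ∀ A : ℝ, 0 ≤ A → ∀ r : ℝ, 0 < r →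
      ENNReal.ofReal (κ * A ^ 3) ≤
        cknC r (((1 : ℝ), (0 : EuclideanSpace ℝ (Fin 3))) : ℝ × EuclideanSpace ℝ (Fin 3))
          (fun (t : ℝ) (x : EuclideanSpace ℝ (Fin 3)) => if t < 1 then
            (A * (1 - t)⁻¹ * expNegInvGlue (4 - ‖x‖ ^ 2 / (1 - t))) •
              (WithLp.toLp 2 ![-(x 1), x 0, 0] : EuclideanSpace ℝ (Fin 3)) else 0) := by
  -- the unit-ball volume `|B₁| ∈ (0, ∞)`
  have hvtop : volume (Metric.ball (0 : EuclideanSpace ℝ (Fin 3)) 1) ≠ ⊤ := measure_ball_lt_top.ne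
  have hVpos : 0 < (volume (Metric.ball (0 : EuclideanSpace ℝ (Fin 3)) 1)).toReal :=
    ENNReal.toReal_pos (Metric.measure_ball_pos volume (0 : EuclideanSpace ℝ (Fin 3)) one_pos).ne' hvtop
  have hg : 0 < expNegInvGlue 1 := expNegInvGlue.pos_of_pos one_pos
  refine ⟨1331 / 20000000 * expNegInvGlue 1 ^ 3 *
    (volume (Metric.ball (0 : EuclideanSpace ℝ (Fin 3)) 1)).toReal, by positivity, ?_⟩
  intro A hA r hr
  have hr2 : 0 < r ^ 2 := pow_pos hr 2
  have hm : 0 ≤ A * (4 / r ^ 2) * expNegInvGlue 1 * (11 * r / 20) :=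
    mul_nonneg (mul_nonneg (mul_nonneg hA (by positivity)) hg.le) (by positivity)
  -- `B((3r/5) e₀, r/20) ⊆ B(0, r)`
  have hball : Metric.ball (EuclideanSpace.single 0 (3 * r / 5) : EuclideanSpace ℝ (Fin 3)) (r / 20) ⊆
      Metric.ball (0 : EuclideanSpace ℝ (Fin 3)) r := by
    intro x hx
    rw [Metric.mem_ball, dist_zero_right]
    have := (selfSimilarSwirl_loadFloor_ball hr x hx).1
    linarith
  -- the generic lower bound on the product sub-region
  have hC := kinWitness_cknC_lowerBound_of_le_norm
    (fun (t : ℝ) (x : EuclideanSpace ℝ (Fin 3)) => if t < 1 then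
      (A * (1 - t)⁻¹ * expNegInvGlue (4 - ‖x‖ ^ 2 / (1 - t))) •
        (WithLp.toLp 2 ![-(x 1), x 0, 0] : EuclideanSpace ℝ (Fin 3)) else 0)
    1 0 r hr (1 - r ^ 2 / 4) (1 - r ^ 2 / 5) (r / 20) (A * (4 / r ^ 2) * expNegInvGlue 1 * (11 * r / 20))
    (EuclideanSpace.single 0 (3 * r / 5)) (by linarith) (by linarith) (by linarith) (by positivity) hm
    hball (fun t ht x hx => selfSimilarSwirl_loadFloor_pointwise hA hr t ht x hx)
  refine le_trans (le_of_eq ?_) hC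
  -- `κ A³ = ((b - a) s³ m³ / r²) |B₁|`, scale free
  have hba : 0 < 1 - r ^ 2 / 5 - (1 - r ^ 2 / 4) := by linarith
  have hnonneg : 0 ≤ (1 - r ^ 2 / 5 - (1 - r ^ 2 / 4)) * (r / 20) ^ 3 *
      (A * (4 / r ^ 2) * expNegInvGlue 1 * (11 * r / 20)) ^ 3 / r ^ 2 := by
    positivity
  have hkey : 1331 / 20000000 * expNegInvGlue 1 ^ 3 *
        (volume (Metric.ball (0 : EuclideanSpace ℝ (Fin 3)) 1)).toReal * A ^ 3 =
      (1 - r ^ 2 / 5 - (1 - r ^ 2 / 4)) * (r / 20) ^ 3 *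
        (A * (4 / r ^ 2) * expNegInvGlue 1 * (11 * r / 20)) ^ 3 / r ^ 2 *
        (volume (Metric.ball (0 : EuclideanSpace ℝ (Fin 3)) 1)).toReal := by
    field_simp
    ring
  rw [hkey, ENNReal.ofReal_mul hnonneg, ENNReal.ofReal_toReal hvtop]

end Summit.NavierStokesRegularity.NavierStokesRegularity.Theorems
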